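import Summits.BirchSwinnertonDyer.Rank1Residual.X4.KuriharaLevelLoweringTwist
import HarnessLib

/-!
# Level lowering kills Kurihara numbers mod `p`, part 4b: the certificate transports along the twist by a character of ANY ORDER — the nebentypus bookkeeping behind the principal-series rows (cell `b2b-bsdres`, seat additive-p4, line V78)

HONEST FRAMING (verbatim, cell `b2b-bsdres`): the goal of the cell is to DELETE the COMBINATION-SHAPED
residual classes for ALL analytic-rank `≤ 1` curves over `ℚ` — "full BSD formula for every rank `≤ 1`
curve in class `C`" assembled STRICTLY from published theorems — so that the rank-`≤ 1` remainder
becomes exactly the CONSTRUCTION-SHAPED classes, which are TYPED (missing-input Props), NOT attempted;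
this is not "finishing BSD". This file: research-route KERNEL THEOREMS (pure algebra over the tree's
`IsPeriodic` / `HeckeRel` / `PlusSymbolLevelLowersAt`; no named fact, no conjecture, no definition,
nothing booked; class X4 stays CONSTRUCTION-SHAPED).

## What is proved

Part 4 (`X4/KuriharaLevelLoweringTwist`) transported the finite level-lowering certificate
`PlusSymbolLevelLowersAt W p f ℓ` along a QUADRATIC twist: its twist algebra (`twistSum_natMul`,
`heckeRel_twistSum`, `twistSum_oldform`) carries the hypothesis `χ(k)² = 1` throughout, because for a
quadratic `χ` the twisted form again has trivial character and the same weight-2 Hecke relation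
`∑_{j mod q} μ((r+j)/q) + μ(qr) = a μ(r)`. For a character `χ` of order `> 2` the source of the twist is
a newform WITH NEBENTYPUS, whose modular symbol obeys the Hecke relation with the character value
`ε = ψ(q)` on the `μ(qr)` term, `∑_{j mod q} μ((r+j)/q) + ε μ(qr) = a μ(r)` (the operator
`T_q = ∑_j [1 j; 0 q] + ψ(q)[q 0; 0 1]` on `S₂(Γ₀(M), ψ)`; Shimura 1971 Thm. 3.24 / (3.5.12)). This file
removes the quadratic restriction and does the nebentypus bookkeeping:

* §1 (any commutative ring `R`, any modulus `m`, any `χ : ℤ/m →* R`, NO hypothesis on the order of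
  `χ`; `T_χμ(r) := ∑_{u mod m} χ(u) μ(r + u/m)`): `map_mul_twistSum_natMul` — for `k` a unit mod `m`,
  `χ(k) · ∑_u χ(u) μ(s + k·u/m) = T_χμ(s)` (substitute `u ↦ ku`; inverse-free form);
  `twistSum_natMul_of_mul_eq_one` — with an inverse value `c χ(k) = 1`,
  `∑_u χ(u) μ(s + k·u/m) = c · T_χμ(s)`; **`twistSum_heckeRel_nebentypus`** — if `μ` satisfies the
  Hecke relation at `q` with nebentypus value `ε` and eigenvalue `a`, and `c χ(q) = 1`, then `T_χμ`
  satisfies it with nebentypus value `ε c²` and eigenvalue `a c` (the twist by `χ` multiplies `a_q` by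
  `χ̄(q)` and the character by `χ̄(q)²` — Shimura 1971 Prop. 3.64: `f ∈ S₂(M, ψ) ↦ f_χ̄ ∈ S₂(Mm², ψχ̄²)`);
  `heckeRel_twistSum_of_mul_eq_one` — in particular `HeckeRel (T_χμ) q (a c)` when `ε c² = 1`
  (the twist has TRIVIAL character: the case of an elliptic curve `W` with `f_W = g ⊗ χ̄`);
  `twistSum_oldform_of_mul_eq_one` — an `ℓ`-old identity `φ = μ − w μ∘[ℓ]` twists to
  `T_χφ = T_χμ − (w c)·(T_χμ)∘[ℓ]` for `c χ(ℓ) = 1`. Part 4's three statements are the case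
  `c = χ(k)`, `ε = 1` of these.
* §2 **`plusSymbolLevelLowersAt_of_charTwistSum`** — the TRANSPORT TEMPLATE: if the mod-`p` plus
  symbol of `f_W` is `c₀ · T_χσ` for some function `σ : ℚ → ℤ/p` (`hsym`), `σ = μ − w μ∘[ℓ]` with
  `μ` periodic (`hV`), and at every Kolyvagin prime `q` of `(W, p)` `μ` satisfies a Hecke relation
  with nebentypus value `ε_q` and eigenvalue `e_q`, where for some `c_q` with `c_q χ(q) = 1` one has
  `ε_q c_q² = 1` and `e_q c_q ≡ a_q(W)`; `ℓ` a unit mod `m`, `c_ℓ χ(ℓ) = 1`, `w c_ℓ = 1` — THEN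
  `PlusSymbolLevelLowersAt W p f_W ℓ` with witness `μ_W = c₀ · T_χμ`. Hence every consequence of
  part 3 (`kuriharaNumber_eq_zero_of_plusSymbolLevelLowersAt`, `∂^{(∞)} ≥ 1`, the closures of
  `X4/KimDefectLevelLowering`) applies to `W` with a certificate computed on the character side.
* §3 THE CONDUCTOR-`p` CASE (`m = p`, `χ : ℤ/p →* ℤ/p` — the shape of an additive PRINCIPAL-SERIES
  prime `p` of `W`: `ρ_W|_{I_p} = χ₁ ⊕ χ₁⁻¹`, `χ₁` of order `e ∣ p − 1`, `e > 2`, so that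
  `f_W = g ⊗ χ̄` for a newform `g` of level `pM′` with nebentypus of conductor `p` and `χ mod p` with
  values in `𝔽_p^× ⊇ μ_e`): the Kolyvagin primes of `(W, p)` are `≡ 1 (mod p)`
  (`natCast_zmod_eq_one_of_isKolyvaginPrime`), so `χ(q) = 1` for EVERY `χ : ℤ/p →* R`
  (`map_natCast_eq_one_of_isKolyvaginPrime`) — the nebentypus and the twist are INVISIBLE in the Hecke
  data at the Kolyvagin primes — and the template reads
  **`plusSymbolLevelLowersAt_of_charTwistSum_conductor`**: plain `T_q`-eigen `μ` with eigenvalue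
  `a_q(W)` at the Kolyvagin primes, and the ONE visible effect of the character is the `ℓ`-old SIGN,
  `w = χ(ℓ)` (a root of unity of order dividing `e`, instead of `±1`).

Where the hypotheses come from (not asserted here; none is in the tree for characters of order `> 2`):
`hsym` = Shimura 1971 Prop. 3.64 at the level of modular symbols for a form with nebentypus,
`{∞, r}_{g ⊗ χ̄} = g(χ)⁻¹ ∑_u χ(u){∞, r + u/m}_g` (the tree's `ModularForms.modularSymbol_charTwist`
is the quadratic `Γ₀`-case only) + `p`-adic unit-ness of the period ratio; the `V`-side function `σ` is
the reduction mod `𝔭 ∣ p` of the plus symbol of `g` (values in `𝔽_p` since `e ∣ p − 1` splits `p` in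
`ℚ(ζ_e)`) — an ABSTRACT function here, the tree having no modular symbols for `Γ₁(M)`; the `ℓ`-old
identity of sign `w = χ(ℓ)` = Ribet level lowering for `ρ̄_g = ρ̄_W ⊗ χ` at a Tamagawa-defect prime
`ℓ` of `W` (`a_ℓ(g) = χ(ℓ) a_ℓ(W) = χ(ℓ)`, `U_ℓ`-eigenvalue `β ≡ χ(ℓ)ℓ`, `w = β/ℓ`) + mod-`p`
multiplicity one — a per-pair certificate, never a fact. The cell's row of this shape is 11760bb1 at
`p = 7` (`e = 3`, `7 ≡ 1 (mod 3)`: principal series; seat memo V76 §4); nothing about it is proved here.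

## References

* G. Shimura, *Introduction to the arithmetic theory of automorphic functions* (1971), Thm. 3.24,
  (3.5.12), Prop. 3.64. [cite: Shimura1971, Prop. 3.64]
* B. Mazur, J. Tate, J. Teitelbaum, Invent. Math. 84 (1986), §I.4 (4.2), §I.8. [cite: MazurTateTeitelbaum1986Invent, §I.4 (4.2) and §I.8]
* C.-H. Kim, Amer. J. Math. 148 (2026), §1.2.2, §1.4.3. [cite: Kim2022StructureSelmer, §1.2.2 and §1.4.3]
-/

noncomputable section

open scoped MatrixGroups ModularForm

open CongruenceSubgroup Finset

open Literature.NumberTheory.EllipticCurves Literature.NumberTheory.EllipticCurves.ModularForms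

namespace Summit.BirchSwinnertonDyer.Rank1Residual.LevelLowering

variable {R : Type*} [CommRing R]

/-! ### §1 Twisted sums by a character of any order: re-indexing, Hecke with nebentypus, oldform shape -/

section TwistAlgebra

variable {m : ℕ} [NeZero m] (χ : ZMod m →* R) {μ : ℚ → R}

omit [CommRing R] in
/-- A periodic `μ` evaluated at `s + n/m` only sees `n mod m`. [folklore] -/
private theorem apply_add_natCast_div_eq (hμ : IsPeriodic μ) (s : ℚ) (n : ℕ) :
    μ (s + (n : ℚ) / m) = μ (s + (((n : ZMod m).val : ℕ) : ℚ) / m) := by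
  rw [ZMod.val_natCast]
  have hm : (m : ℚ) ≠ 0 := by exact_mod_cast NeZero.ne m
  have hk : ((n % m : ℕ) : ℚ) = (n : ℚ) - (m : ℚ) * ((n / m : ℕ) : ℚ) := by
    have h' : ((n % m : ℕ) : ℚ) + (m : ℚ) * ((n / m : ℕ) : ℚ) = (n : ℚ) := by
      exact_mod_cast Nat.mod_add_div n m
    linarith
  refine hμ.eq_of_eq_add_int ((n / m : ℕ) : ℤ) ?_
  rw [Int.cast_natCast, hk]
  field_simp
  ring

/-- **Re-indexing by a unit, for a character of any order** (inverse-free form): for `k`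
invertible mod `m`, `χ(k) · ∑_u χ(u) μ(s + k·u/m) = ∑_u χ(u) μ(s + u/m)` (substitute `u ↦ ku`:
`χ(k)χ(u) = χ(ku)` and `μ(s + k·u/m) = μ(s + (ku)/m)` by periodicity).
[cite: MazurTateTeitelbaum1986Invent, §I.8] -/
theorem map_mul_twistSum_natMul (hμ : IsPeriodic μ) {k : ℕ} (hk : IsUnit ((k : ℕ) : ZMod m))
    (s : ℚ) :
    χ k * ∑ u : ZMod m, χ u * μ (s + (k : ℚ) * u.val / m) =
      ∑ u : ZMod m, χ u * μ (s + (u.val : ℚ) / m) := by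
  have hterm : ∀ u : ZMod m, χ k * (χ u * μ (s + (k : ℚ) * u.val / m)) =
      χ ((k : ZMod m) * u) * μ (s + ((((k : ZMod m) * u).val : ℕ) : ℚ) / m) := by
    intro u
    have h1 : μ (s + (k : ℚ) * u.val / m) = μ (s + ((((k : ZMod m) * u).val : ℕ) : ℚ) / m) := by
      have := apply_add_natCast_div_eq (m := m) hμ s (k * u.val)
      rw [show ((k * u.val : ℕ) : ZMod m) = (k : ZMod m) * u by
        rw [Nat.cast_mul, ZMod.natCast_zmod_val]] at this
      rw [← this]
      congr 1
      push_cast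
      ring
    rw [h1, map_mul, mul_assoc]
  rw [Finset.mul_sum]
  simp_rw [hterm]
  exact Equiv.sum_comp hk.unit.mulLeft (fun v : ZMod m ↦ χ v * μ (s + (v.val : ℚ) / m))

/-- **Re-indexing with an inverse value**: if `c · χ(k) = 1` (so `c = χ(k)⁻¹ = χ̄(k)`), then
`∑_u χ(u) μ(s + k·u/m) = c · ∑_u χ(u) μ(s + u/m)`. Part 4's `twistSum_natMul` is the case
`c = χ(k)`, `χ(k)² = 1`. [cite: MazurTateTeitelbaum1986Invent, §I.8] -/
theorem twistSum_natMul_of_mul_eq_one (hμ : IsPeriodic μ) {k : ℕ}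
    (hk : IsUnit ((k : ℕ) : ZMod m)) {c : R} (hc : c * χ k = 1) (s : ℚ) :
    ∑ u : ZMod m, χ u * μ (s + (k : ℚ) * u.val / m) =
      c * ∑ u : ZMod m, χ u * μ (s + (u.val : ℚ) / m) := by
  rw [← map_mul_twistSum_natMul χ hμ hk s, ← mul_assoc, hc, one_mul]

/-- **The twist by `χ` multiplies the Hecke eigenvalue by `χ̄(q)` and the nebentypus by `χ̄(q)²`.**
If `μ` satisfies the weight-2 Hecke relation at `q` (invertible mod `m`, `q ≠ 0`) WITH NEBENTYPUS
value `ε` and eigenvalue `a`, `∑_{j mod q} μ((s+j)/q) + ε μ(qs) = a μ(s)` for all `s`, and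
`c χ(q) = 1`, then the twisted sum `T(r) = ∑_u χ(u) μ(r + u/m)` satisfies
`∑_{j mod q} T((r+j)/q) + (ε c²) T(qr) = (a c) T(r)`: the Hecke sum of `T` at `r` unfolds to
`∑_u χ(u)(a μ(r + q·u/m) − ε μ(qr + q²·u/m))`, and the two shifted sums re-index with the inverse
values `c` and `c²`. (Shimura 1971 Prop. 3.64: `g ∈ S₂(M, ψ)`, `g_χ̄ ∈ S₂(Mm², ψχ̄²)` with
`a_q(g_χ̄) = χ̄(q)a_q(g)`; MTT §I.4 (4.2) for the symbol relation.)
[cite: Shimura1971, Prop. 3.64] [cite: MazurTateTeitelbaum1986Invent, §I.4 (4.2)] -/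
theorem twistSum_heckeRel_nebentypus (hμ : IsPeriodic μ) {q : ℕ} (hq0 : q ≠ 0)
    (hq : IsUnit ((q : ℕ) : ZMod m)) {c : R} (hc : c * χ q = 1) {ε a : R}
    (hH : ∀ s : ℚ, ∑ j ∈ Finset.range q, μ ((s + j) / q) + ε * μ (q * s) = a * μ s) (r : ℚ) :
    ∑ j ∈ Finset.range q, (∑ u : ZMod m, χ u * μ ((r + j) / q + (u.val : ℚ) / m)) +
        (ε * c ^ 2) * ∑ u : ZMod m, χ u * μ (q * r + (u.val : ℚ) / m) =
      (a * c) * ∑ u : ZMod m, χ u * μ (r + (u.val : ℚ) / m) := by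
  have hqQ : (q : ℚ) ≠ 0 := by exact_mod_cast hq0
  -- the Hecke relation of `μ` at the shifted points `r + q u/m`
  have hrow : ∀ u : ZMod m, ∑ j ∈ Finset.range q, μ ((r + j) / q + (u.val : ℚ) / m) =
      a * μ (r + (q : ℚ) * u.val / m) - ε * μ (q * r + ((q ^ 2 : ℕ) : ℚ) * u.val / m) := by
    intro u
    have h := hH (r + (q : ℚ) * u.val / m)
    have e1 : ∀ j : ℕ, (r + (q : ℚ) * u.val / m + j) / q = (r + j) / q + (u.val : ℚ) / m := by
      intro j; field_simp; ring
    have e2 : (q : ℚ) * (r + (q : ℚ) * u.val / m) = q * r + ((q ^ 2 : ℕ) : ℚ) * u.val / m := by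
      push_cast; ring
    simp_rw [e1, e2] at h
    exact eq_sub_of_add_eq h
  -- exchange the two sums and apply `hrow`
  rw [Finset.sum_comm]
  simp_rw [← Finset.mul_sum, hrow, mul_sub, Finset.sum_sub_distrib]
  -- re-index the two shifted twisted sums with the inverse values `c` and `c²`
  have hunit2 : IsUnit (((q ^ 2 : ℕ) : ℕ) : ZMod m) := by
    rw [Nat.cast_pow]; exact hq.pow 2
  have hc2 : c ^ 2 * χ ((q ^ 2 : ℕ) : ZMod m) = 1 := by
    rw [Nat.cast_pow, map_pow, ← mul_pow, hc, one_pow]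
  have hA : ∑ u : ZMod m, χ u * (a * μ (r + (q : ℚ) * u.val / m)) =
      a * (c * ∑ u : ZMod m, χ u * μ (r + (u.val : ℚ) / m)) := by
    rw [← twistSum_natMul_of_mul_eq_one χ hμ hq hc, Finset.mul_sum]
    exact Finset.sum_congr rfl fun u _ ↦ by ring
  have hB : ∑ u : ZMod m, χ u * (ε * μ (q * r + ((q ^ 2 : ℕ) : ℚ) * u.val / m)) =
      ε * (c ^ 2 * ∑ u : ZMod m, χ u * μ (q * r + (u.val : ℚ) / m)) := by
    rw [← twistSum_natMul_of_mul_eq_one χ hμ hunit2 hc2, Finset.mul_sum]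
    exact Finset.sum_congr rfl fun u _ ↦ by ring
  rw [hA, hB]
  ring

/-- **Trivial character after the twist**: under the hypotheses of `twistSum_heckeRel_nebentypus`,
if moreover `ε c² = 1` (the nebentypus `ψ` of the source satisfies `ψ(q)χ̄(q)² = 1`, i.e. the twisted
form has trivial character at `q`), the twisted sum satisfies the tree's plain weight-2 Hecke relation
`HeckeRel` with eigenvalue `a c` (`= χ̄(q) a_q(g) = a_q(g ⊗ χ̄)`). Part 4's `heckeRel_twistSum` is the
case `ε = 1`, `c = χ(q)`, `χ(q)² = 1`. [cite: MazurTateTeitelbaum1986Invent, §I.4 (4.2)] -/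
theorem heckeRel_twistSum_of_mul_eq_one (hμ : IsPeriodic μ) {q : ℕ} (hq0 : q ≠ 0)
    (hq : IsUnit ((q : ℕ) : ZMod m)) {c : R} (hc : c * χ q = 1) {ε a : R} (hε : ε * c ^ 2 = 1)
    (hH : ∀ s : ℚ, ∑ j ∈ Finset.range q, μ ((s + j) / q) + ε * μ (q * s) = a * μ s) :
    HeckeRel (fun r ↦ ∑ u : ZMod m, χ u * μ (r + (u.val : ℚ) / m)) q (a * c) := by
  intro r
  have h := twistSum_heckeRel_nebentypus χ hμ hq0 hq hc hH r
  rw [hε, one_mul] at h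
  simpa only using h

/-- The tree's `HeckeRel μ q a` is the Hecke relation with nebentypus value `ε = 1`. [folklore] -/
theorem heckeRel_iff_nebentypus_one {ν : ℚ → R} {q : ℕ} {a : R} :
    HeckeRel ν q a ↔
      ∀ s : ℚ, ∑ j ∈ Finset.range q, ν ((s + j) / q) + 1 * ν (q * s) = a * ν s := by
  simp only [HeckeRel, one_mul]

/-- **An `ℓ`-old identity twists to an `ℓ`-old identity with the sign multiplied by `χ̄(ℓ)`**:
if `φ = μ − w·μ∘[ℓ]` with `ℓ` invertible mod `m` and `c χ(ℓ) = 1`, then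
`T_χφ(r) = T_χμ(r) − (w c) · T_χμ(ℓ r)`. Part 4's `twistSum_oldform` is the case `c = χ(ℓ)`.
[cite: MazurTateTeitelbaum1986Invent, §I.8] -/
theorem twistSum_oldform_of_mul_eq_one (hμ : IsPeriodic μ) {φ : ℚ → R} {w : R} {ℓ : ℕ}
    (hℓ : IsUnit ((ℓ : ℕ) : ZMod m)) {c : R} (hc : c * χ ℓ = 1)
    (hφ : ∀ r : ℚ, φ r = μ r - w * μ (ℓ * r)) (r : ℚ) :
    ∑ u : ZMod m, χ u * φ (r + (u.val : ℚ) / m) =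
      ∑ u : ZMod m, χ u * μ (r + (u.val : ℚ) / m) -
        (w * c) * ∑ u : ZMod m, χ u * μ (ℓ * r + (u.val : ℚ) / m) := by
  have e : ∀ u : ZMod m, (ℓ : ℚ) * (r + (u.val : ℚ) / m) = ℓ * r + (ℓ : ℚ) * u.val / m := by
    intro u; ring
  simp_rw [hφ, e, mul_sub, Finset.sum_sub_distrib]
  rw [show ∑ u : ZMod m, χ u * (w * μ (ℓ * r + (ℓ : ℚ) * u.val / m)) =
      w * ∑ u : ZMod m, χ u * μ (ℓ * r + (ℓ : ℚ) * u.val / m) by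
    rw [Finset.mul_sum]; exact Finset.sum_congr rfl fun u _ ↦ by ring,
    twistSum_natMul_of_mul_eq_one χ hμ hℓ hc, mul_assoc]

/-- A Hecke relation survives multiplication of the function by a constant. [folklore] -/
private theorem heckeRel_const_mul_left {ν : ℚ → R} {q : ℕ} {a : R} (h : HeckeRel ν q a) (c : R) :
    HeckeRel (fun r ↦ c * ν r) q a := by
  intro r
  have := congrArg (fun x ↦ c * x) (h r)
  simp only [mul_add, Finset.mul_sum] at this
  simp only
  rw [this]
  ring

end TwistAlgebra

/-! ### §2 The certificate transports along the twist by a character of any order -/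

section Transport

variable (W : WeierstrassCurve ℚ) [W.IsGloballyMinimal] (p : ℕ) [Fact p.Prime]
  {m : ℕ} [NeZero m] (χ : ZMod m →* ZMod p) {NW : ℕ} (fW : CuspForm (Gamma0 NW) 2)

/-- **TRANSPORT OF THE LEVEL-LOWERING CERTIFICATE ALONG A TWIST BY A CHARACTER OF ANY ORDER
(template).** Data: a character `χ : ℤ/m →* ℤ/p`; a cusp form `f_W` whose mod-`p` plus symbol is the
twisted sum, with one constant `c₀`, of a function `σ : ℚ → ℤ/p` (the reduced symbol of the source
newform, possibly with nebentypus), `[r]⁺_{f_W} ≡ c₀ · ∑_{u mod m} χ(u) σ(r + u/m)` (`hsym`); an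
`ℓ`-OLD identity with sign `w`, `σ = μ − w μ∘[ℓ]` (`hV`), `μ` periodic; at every Kolyvagin prime
`q` of `(W, p)`: a Hecke relation for `μ` with nebentypus value `ε_q` and eigenvalue `e_q`, `q`
invertible mod `m`, an inverse value `c_q χ(q) = 1` with `ε_q c_q² = 1` (the twist has trivial
character) and `e_q c_q ≡ a_q(W)` (`hH`); `ℓ` invertible mod `m`, `c_ℓ χ(ℓ) = 1` and `w c_ℓ = 1`.
THEN `PlusSymbolLevelLowersAt W p f_W ℓ`, with the witness `μ_W = c₀ · T_χμ` (§1: periodic,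
`T_q`-eigen with eigenvalue `e_q c_q = a_q(W)`, and `c₀·T_χ(μ − wμ∘[ℓ]) = μ_W − (w c_ℓ) μ_W∘[ℓ]
= μ_W − μ_W∘[ℓ]`). Part 4's `plusSymbolLevelLowersAt_of_twistSum` is the case `ε_q = 1`,
`c_q = χ(q)`, `χ(q)² = 1`, `σ` = the reduced symbol of a `Γ₀`-form.
[cite: Kim2022StructureSelmer, §1.2.2 and §1.4.3] [cite: MazurTateTeitelbaum1986Invent, §I.4 (4.2) and §I.8] -/
theorem plusSymbolLevelLowersAt_of_charTwistSum (c₀ : ZMod p) {σ : ℚ → ZMod p}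
    (hsym : ∀ r : ℚ, ((ratPlusSymbol fW r : ℚ) : ZMod p) =
      c₀ * ∑ u : ZMod m, χ u * σ (r + (u.val : ℚ) / m))
    {μ : ℚ → ZMod p} (hμ : IsPeriodic μ) {w : ZMod p} {ℓ : ℕ}
    (hV : ∀ r : ℚ, σ r = μ r - w * μ (ℓ * r))
    (hℓ : IsUnit ((ℓ : ℕ) : ZMod m)) {cℓ : ZMod p} (hcℓ : cℓ * χ ℓ = 1) (hw : w * cℓ = 1)
    (ε e c : ℕ → ZMod p)
    (hH : ∀ q : ℕ, Kato.IsKolyvaginPrime W p 1 q →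
      (∀ s : ℚ, ∑ j ∈ Finset.range q, μ ((s + j) / q) + ε q * μ (q * s) = e q * μ s) ∧
        IsUnit ((q : ℕ) : ZMod m) ∧ c q * χ q = 1 ∧ ε q * c q ^ 2 = 1 ∧
        e q * c q = (W.frobeniusTrace q : ZMod p)) :
    PlusSymbolLevelLowersAt W p fW ℓ := by
  refine ⟨fun r ↦ c₀ * ∑ u : ZMod m, χ u * μ (r + (u.val : ℚ) / m), ?_, ?_, ?_⟩
  · -- periodicity
    intro r z
    have hper := isPeriodic_twistSum χ hμ r z
    simp only at hper ⊢
    rw [hper]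
  · -- Hecke at the Kolyvagin primes of `(W, p)`
    intro q hq
    obtain ⟨hHq, hqu, hcq, hεq, haq⟩ := hH q hq
    rw [← haq]
    exact heckeRel_const_mul_left
      (heckeRel_twistSum_of_mul_eq_one χ hμ hq.prime.ne_zero hqu hcq hεq hHq) c₀
  · -- the symbol identity
    intro r
    rw [hsym r, twistSum_oldform_of_mul_eq_one χ hμ hℓ hcℓ hV r, hw, one_mul, mul_sub]

end Transport

/-! ### §3 The conductor-`p` case: the character is invisible at the Kolyvagin primes -/

section Conductor

variable (W : WeierstrassCurve ℚ) [W.IsGloballyMinimal] (p : ℕ) [hp : Fact p.Prime]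

/-- **A Kolyvagin prime of `(W, p)` is `1` in `ℤ/p`** (`q ≡ 1 (mod p)` is part of Kim's definition
of `𝒫₁`). [cite: Kim2022StructureSelmer, §1.2.2] -/
theorem natCast_zmod_eq_one_of_isKolyvaginPrime {q : ℕ} (hq : Kato.IsKolyvaginPrime W p 1 q) :
    (q : ZMod p) = 1 := by
  have h := hq.modEq_one
  rw [pow_one] at h
  rw [← Nat.cast_one]
  exact (ZMod.natCast_eq_natCast_iff q 1 p).mpr h

/-- **Every character of conductor `p` is trivial at the Kolyvagin primes of `(W, p)`**: for any
monoid homomorphism `χ : ℤ/p →* R`, `χ(q) = 1` — so neither a nebentypus of conductor `p` nor a twist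
by a character mod `p` is visible in the Hecke data of the certificate.
[cite: Kim2022StructureSelmer, §1.2.2] -/
theorem map_natCast_eq_one_of_isKolyvaginPrime (χ : ZMod p →* R) {q : ℕ}
    (hq : Kato.IsKolyvaginPrime W p 1 q) : χ (q : ZMod p) = 1 := by
  rw [natCast_zmod_eq_one_of_isKolyvaginPrime W p hq, map_one]

variable (χ : ZMod p →* ZMod p) {NW : ℕ} (fW : CuspForm (Gamma0 NW) 2)

/-- **THE PRINCIPAL-SERIES TEMPLATE (conductor `p`).** For `χ : ℤ/p →* ℤ/p` (of any order) the
transport of §2 needs only: the twisted-sum identity `[r]⁺_{f_W} ≡ c₀ ∑_{u mod p} χ(u) σ(r + u/p)`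
(`hsym`); `σ = μ − w μ∘[ℓ]` with `μ` periodic and PLAINLY `T_q`-eigen with eigenvalue `a_q(W)` at
the Kolyvagin primes of `(W, p)` (`hH` — there `q ≡ 1 (mod p)`, so `χ(q) = 1` and any conductor-`p`
nebentypus value is `1`); `p ∤ ℓ`; and the `ℓ`-old SIGN IS THE CHARACTER VALUE, `w = χ(ℓ)`. THEN
`PlusSymbolLevelLowersAt W p f_W ℓ`. (The inverse values of §2 are `c_q = 1` and `c_ℓ = χ(ℓ⁻¹)`.)
[cite: Kim2022StructureSelmer, §1.2.2 and §1.4.3] [cite: MazurTateTeitelbaum1986Invent, §I.4 (4.2) and §I.8] -/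
theorem plusSymbolLevelLowersAt_of_charTwistSum_conductor (c₀ : ZMod p) {σ : ℚ → ZMod p}
    (hsym : ∀ r : ℚ, ((ratPlusSymbol fW r : ℚ) : ZMod p) =
      c₀ * ∑ u : ZMod p, χ u * σ (r + (u.val : ℚ) / p))
    {μ : ℚ → ZMod p} (hμ : IsPeriodic μ) {w : ZMod p} {ℓ : ℕ} (hℓ : ¬ p ∣ ℓ)
    (hV : ∀ r : ℚ, σ r = μ r - w * μ (ℓ * r)) (hw : w = χ ℓ)
    (hH : ∀ q : ℕ, Kato.IsKolyvaginPrime W p 1 q → HeckeRel μ q (W.frobeniusTrace q : ZMod p)) :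
    PlusSymbolLevelLowersAt W p fW ℓ := by
  have hℓ0 : ((ℓ : ℕ) : ZMod p) ≠ 0 := mt (ZMod.natCast_eq_zero_iff _ _).mp hℓ
  have hℓu : IsUnit ((ℓ : ℕ) : ZMod p) := hℓ0.isUnit
  -- the inverse value at `ℓ` is `χ(ℓ⁻¹)`
  have hcℓ : χ ((ℓ : ZMod p)⁻¹) * χ ℓ = 1 := by
    rw [← map_mul, inv_mul_cancel₀ hℓ0, map_one]
  have hw' : w * χ ((ℓ : ZMod p)⁻¹) = 1 := by
    rw [hw, ← map_mul, mul_inv_cancel₀ hℓ0, map_one]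
  refine plusSymbolLevelLowersAt_of_charTwistSum W p χ fW c₀ hsym hμ hV hℓu hcℓ hw'
    (fun _ ↦ 1) (fun q ↦ (W.frobeniusTrace q : ZMod p)) (fun _ ↦ 1) fun q hq ↦ ?_
  have hq1 : (q : ZMod p) = 1 := natCast_zmod_eq_one_of_isKolyvaginPrime W p hq
  refine ⟨fun s ↦ ?_, ?_, ?_, ?_, ?_⟩
  · simp only [one_mul]
    exact hH q hq s
  · rw [hq1]; exact isUnit_one
  · simp only [one_mul, hq1, map_one]
  · simp only [one_pow, mul_one]
  · simp only [mul_one]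

end Conductor

end Summit.BirchSwinnertonDyer.Rank1Residual.LevelLowering

end
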